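/-
Copyright (c) 2026 the pub-hodgecm-mathlib formalisation cell (harness21).  Prover seat hodgecm-mathlib-K2Liu-p09 (g0): Track B «K2-LIT»,
#184♮ = hLiu418 = stmt-HodgeConjecture-24832, file #9 of the K2_Liu road (socket module
`Cruxes/HLiu418/Lines/K2_Liu_CurveThetaSigs_U3a_SiegelEisenstein.lean`), organ (III-b) steps E3a + assembly; 2026-09-03.
-/
import Summits.HodgeConjecture.HodgeConjecture.Theorems.K2LiuSiegelDoubledHeightSmear              -- ★ step (a)
import Summits.HodgeConjecture.HodgeConjecture.Theorems.K2LiuSiegelDoubledRationalMultiplicity     -- ★ step (b1)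
import Summits.HodgeConjecture.HodgeConjecture.Theorems.K2LiuSiegelDoubledCountVsIntegral          -- ★ step E2
import Summits.HodgeConjecture.HodgeConjecture.Theorems.K2LiuSiegelDoubledUnfold                   -- ★ step E3b
import Summits.HodgeConjecture.HodgeConjecture.Theorems.K2LiuSiegelCharacterTrivialOnRational      -- ★ `modDelta_eq_one_of_mem_ratH`
import Summits.HodgeConjecture.HodgeConjecture.Theorems.K2LiuSiegelEisensteinDoubledLeftInvariant  -- ★ `exists_equiv_siegelDeltaQuot_mulRight`
import HarnessLib

/-!
# Crux `HLiu418`, Track B road `K2_Liu`, unit U3a «SIEGEL EISENSTEIN SERIES», file #9 — helper 8 (organ (III-b), step E3a + assembly):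
# GODEMENT'S COUNT REDUCED TO THE SIEGEL-DOMAIN INTEGRAL `∫_{P_Δ(L⁺)\{Φ ≤ C₀}} Φ^τ < ∞`

Cell `hodgecm-mathlib`, crux item hLiu418 = `stmt-HodgeConjecture-24832`, route of record `HCCMUnconditional`; squad K2 ∕ K2Liu,
prover K2Liu-p09 (g0).  THEOREMS ONLY (no `def`, no instance, no notation, no named-fact hypothesis, no `sorry`); lane
`--supports stmt-HodgeConjecture-24832` (count-neutral helper toward socket #9 `sig_K2LiuSiegelEisensteinDoubledSummable`).

For the doubled group `H(𝔸) = U(𝕍 ⊕ −𝕍)(𝔸)` (★ `GRConstruction.HA`) with a left-invariant measure `μ` finite on compacta and positive on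
opens, an Iwasawa decomposition `H(𝔸) = P_Δ(𝔸)·K₀` (★ (I)), a height `Φ` with the four ★ properties of the height of record
(★ `exists_siegelHeight`), `τ ≥ 0` and a `P_Δ(L⁺)`-covering weight `β'` (★ `exists_isCoveringWeight_siegelDeltaRat`):

* §1 `translateSum_ratH_mul` — `G(y) := Σ'_q F(γ_q y)` is left-`H(L⁺)`-invariant for left-`P_Δ(L⁺)`-invariant `F` (re-indexing by the
  permutation `q ↦ q·γ` of `P_Δ(L⁺)\H(L⁺)`, ★ `exists_equiv_siegelDeltaQuot_mulRight`);
* §2 **E3a** `lintegral_indicator_mul_le_of_invariant` — `∫⁻ 1_S · G dμ ≤ m · ∫⁻ G · β dμ` for an `H(L⁺)`-invariant `G`, an `H(L⁺)`-weight `β` and a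
  measurable `S` all of whose translates meet `H(L⁺)` in at most `m` points (insert `1 = Σ_γ β(γ y)`, substitute `y ↦ γ⁻¹ y`, count);
* §3 **THE REDUCTION** `summable_height_rpow_of_lintegral_ne_top`: if `∫⁻ 1_{Φ ≤ C₀} Φ^τ β' dμ < ∞` for every `C₀`, then
  `Σ_{γ ∈ P_Δ(L⁺)\H(L⁺)} Φ(γ h)^τ < ∞` for every `h` — steps (a) smear ★, E2 count ≤ integral ★, floor ★(4), §2, E3b unfold ★.

With ★ reduction (p854785), ★ (I) (p854827) and ★ `exists_siegelHeight` (p854922), socket #9 is thereby reduced to the single analytic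
statement E5: «for `τ > 2n` and some (equivalently every) `P_Δ(L⁺)`-weight `β'`, `∫⁻ 1_{Φ≤C₀} Φ^τ β' dμ < ∞`» — Godement's integral over a
Siegel domain of `P_Δ` ([Garrett2018, §3.10]: «… convergence of `∫_{Z_𝔸 M_k\(Y ∩ M_𝔸)} m^{σ−2ρ} dm`»).

HONEST LABEL.  Count-neutral helper of the K2_Liu road; it retires nothing by itself: `HC_CM` is proved only modulo the 7 printed
citations (2 remaining named inputs: hLiu418 = `stmt-HodgeConjecture-24832`, h413 = `stmt-HodgeConjecture-24833`) until rung 0 closes.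

## References
* [Garrett2018] P. Garrett, *Modern Analysis of Automorphic Forms by Example* (2018), §3.10 (proof of Cor. 3.10.2).
* [MoeglinWaldspurger1995] C. Mœglin, J.-L. Waldspurger, *Spectral Decomposition and Eisenstein Series* (1995), II.1.5.
* [Liu2021] Y. Liu, Camb. J. Math. 9 (2021), App. B §B.3 p. 101, Lem. B.10 (2).
-/

set_option autoImplicit false
-- the mandated namespace repeats the single-problem summit's segment (`HodgeConjecture.HodgeConjecture`)
set_option linter.dupNamespace false

noncomputable section

open scoped Matrix Pointwise ENNReal NNReal
open NumberField IsDedekindDomain MeasureTheory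

namespace Summit.HodgeConjecture.HodgeConjecture.Cruxes.HLiu418.K2LiuSiegelDoubledCountReduction

open Literature.NumberTheory.Automorphic Literature.NumberTheory.Automorphic.UnitaryGroup
open Literature.NumberTheory.GelbartRogawski1991 Literature.NumberTheory.GelbartRogawski1991.GRConstruction
open Literature.NumberTheory.K2Lit.SiegelDoubled
open Literature.MeasureTheory.Group
open Summit.HodgeConjecture.HodgeConjecture.Cruxes.HLiu418.K2LiuSiegelDoubledHeightSmear
open Summit.HodgeConjecture.HodgeConjecture.Cruxes.HLiu418.K2LiuSiegelDoubledRationalMultiplicity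
open Summit.HodgeConjecture.HodgeConjecture.Cruxes.HLiu418.K2LiuSiegelDoubledCountVsIntegral
open Summit.HodgeConjecture.HodgeConjecture.Cruxes.HLiu418.K2LiuSiegelDoubledUnfold
open Summit.HodgeConjecture.HodgeConjecture.Cruxes.HLiu418.K2LiuSiegelCharacterTrivialOnRational
open Summit.HodgeConjecture.HodgeConjecture.Cruxes.HLiu418.K2LiuSiegelEisensteinDoubledLeftInvariant

variable (L : Type) [Field L] [NumberField L] [IsCMField L]
variable {N M n : ℕ} (e : Fin N × Fin M ≃ Fin n)
  (dV : Fin N → L) (hdV : ∀ i, IsCMField.complexConj L (dV i) = dV i)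
  (dW : Fin M → L) (hdW : ∀ i, IsCMField.complexConj L (dW i) = dW i)

/-! ## §1 The translate sum `G(y) = Σ'_q F(γ_q y)` is `H(L⁺)`-invariant -/

/-- **Re-indexing**: for `F` left-`P_Δ(L⁺)`-invariant and `γ ∈ H(L⁺)`, `Σ'_q F(γ_q γ y) = Σ'_q F(γ_q y)` (right multiplication by `γ` permutes
`P_Δ(L⁺)\H(L⁺)`, ★ `exists_equiv_siegelDeltaQuot_mulRight`; `Equiv.tsum_eq`). [cite: Garrett2018, §3.10] -/
theorem translateSum_ratH_mul {α : Type*} [AddCommMonoid α] [TopologicalSpace α] {F : HA L e dV hdV dW hdW → α}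
    (hFinv : ∀ p ∈ siegelDelta L e dV hdV dW hdW ⊓ ratH L e dV hdV dW hdW, ∀ x : HA L e dV hdV dW hdW, F (p * x) = F x)
    (γ : ratH L e dV hdV dW hdW) (y : HA L e dV hdV dW hdW) :
    ∑' q : SiegelDeltaQuot L e dV hdV dW hdW,
        F ((((Quotient.out q : ratH L e dV hdV dW hdW) : HA L e dV hdV dW hdW)) * (((γ : HA L e dV hdV dW hdW)) * y)) =
      ∑' q : SiegelDeltaQuot L e dV hdV dW hdW, F ((((Quotient.out q : ratH L e dV hdV dW hdW) : HA L e dV hdV dW hdW)) * y) := by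
  obtain ⟨σ, hσ⟩ := exists_equiv_siegelDeltaQuot_mulRight L e dV hdV dW hdW γ
  rw [← Equiv.tsum_eq σ (fun q : SiegelDeltaQuot L e dV hdV dW hdW =>
    F ((((Quotient.out q : ratH L e dV hdV dW hdW) : HA L e dV hdV dW hdW)) * y))]
  refine tsum_congr fun q => ?_
  -- `(σ q).out = p * (q.out * γ)` with `p ∈ P_Δ(L⁺)`
  have hq : σ q = Quotient.mk (MulAction.orbitRel (siegelDeltaRat L e dV hdV dW hdW) (ratH L e dV hdV dW hdW))
      (Quotient.out q * γ) := by
    conv_lhs => rw [← Quotient.out_eq q]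
    exact hσ _
  have hrel : MulAction.orbitRel (siegelDeltaRat L e dV hdV dW hdW) (ratH L e dV hdV dW hdW)
      (Quotient.out (σ q)) (Quotient.out q * γ) :=
    Quotient.exact ((Quotient.out_eq (σ q)).trans hq)
  obtain ⟨p, hp⟩ := MulAction.mem_orbit_iff.1 (MulAction.orbitRel_apply.1 hrel)
  rw [Subgroup.smul_def, smul_eq_mul] at hp
  rw [← hp, Subgroup.coe_mul, Subgroup.coe_mul, mul_assoc, mul_assoc,
    hFinv _ (Subgroup.mem_inf.2 ⟨Subgroup.mem_subgroupOf.1 p.2, (p : ratH L e dV hdV dW hdW).2⟩)]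

/-! ## §2 E3a: `∫⁻ 1_S G ≤ m ∫⁻ G β` -/

variable [MeasurableSpace (HA L e dV hdV dW hdW)] [BorelSpace (HA L e dV hdV dW hdW)]

omit [MeasurableSpace (HA L e dV hdV dW hdW)] [BorelSpace (HA L e dV hdV dW hdW)] in
/-- **Bounded multiplicity as a bound on the covering sum of an indicator**: if `#(H(L⁺) ∩ y·S⁻¹) ≤ m` then
`Σ_{γ ∈ H(L⁺)} 1_S(γ⁻¹ y) ≤ m`. [cite: Garrett2018, §3.10] -/
theorem tsum_indicator_inv_smul_le {S : Set (HA L e dV hdV dW hdW)} {m : ℕ} (y : HA L e dV hdV dW hdW)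
    (hfin : (((ratH L e dV hdV dW hdW) : Set (HA L e dV hdV dW hdW)) ∩ y • S⁻¹).Finite)
    (hm : (((ratH L e dV hdV dW hdW) : Set (HA L e dV hdV dW hdW)) ∩ y • S⁻¹).ncard ≤ m) :
    (∑' γ : ratH L e dV hdV dW hdW, S.indicator (fun _ => (1 : ℝ≥0∞)) ((γ : HA L e dV hdV dW hdW)⁻¹ * y)) ≤ m := by
  classical
  -- the summand is the indicator of `A := {γ | γ⁻¹ y ∈ S}`
  set A : Set (ratH L e dV hdV dW hdW) := {γ | ((γ : HA L e dV hdV dW hdW))⁻¹ * y ∈ S} with hA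
  have hsum : (∑' γ : ratH L e dV hdV dW hdW, S.indicator (fun _ => (1 : ℝ≥0∞)) ((γ : HA L e dV hdV dW hdW)⁻¹ * y)) =
      ∑' γ : ratH L e dV hdV dW hdW, A.indicator (fun _ => (1 : ℝ≥0∞)) γ := by
    refine tsum_congr fun γ => ?_
    simp only [Set.indicator_apply, hA, Set.mem_setOf_eq]
  rw [hsum, ← tsum_subtype A (fun _ => (1 : ℝ≥0∞)), ENNReal.tsum_set_one]
  -- `A` injects into `H(L⁺) ∩ y S⁻¹` by the coercion
  have hinj : Set.InjOn (fun γ : ratH L e dV hdV dW hdW => (γ : HA L e dV hdV dW hdW)) A := fun a _ b _ h => Subtype.ext h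
  have hmaps : Set.MapsTo (fun γ : ratH L e dV hdV dW hdW => (γ : HA L e dV hdV dW hdW)) A
      (((ratH L e dV hdV dW hdW) : Set (HA L e dV hdV dW hdW)) ∩ y • S⁻¹) := by
    intro γ hγ
    refine ⟨γ.2, ?_⟩
    -- `γ = y · (γ⁻¹ y)⁻¹` with `(γ⁻¹ y)⁻¹ ∈ S⁻¹`
    refine ⟨(((γ : HA L e dV hdV dW hdW))⁻¹ * y)⁻¹, Set.inv_mem_inv.2 hγ, ?_⟩
    show y * ((((γ : HA L e dV hdV dW hdW))⁻¹ * y)⁻¹) = (γ : HA L e dV hdV dW hdW)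
    rw [mul_inv_rev, inv_inv, mul_inv_cancel_left]
  have hAfin : A.Finite := Set.Finite.of_injOn hmaps hinj hfin
  have hcard : A.ncard ≤ m := (Set.ncard_le_ncard_of_injOn _ hmaps hinj hfin).trans hm
  rw [← hAfin.cast_ncard_eq]
  exact_mod_cast hcard

/-- **E3a.**  Let `G ≥ 0` be measurable and left-`H(L⁺)`-invariant, `β` an `H(L⁺)`-covering weight, `μ` left-invariant, and `S` measurable with
`#(H(L⁺) ∩ y·S⁻¹) ≤ m` for all `y`.  Then `∫⁻ 1_S G dμ ≤ m · ∫⁻ G β dμ`: insert `1 = Σ_γ β(γ y)`, substitute `y ↦ γ⁻¹ y` in each term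
(left invariance, `G(γ⁻¹ y) = G(y)`), and bound `Σ_γ 1_S(γ⁻¹ y) ≤ m`. [cite: Garrett2018, §3.10 (proof of Cor. 3.10.2)]
[cite: MoeglinWaldspurger1995, II.1.5] -/
theorem lintegral_indicator_mul_le_of_invariant (μ : Measure (HA L e dV hdV dW hdW)) [μ.IsMulLeftInvariant]
    {G : HA L e dV hdV dW hdW → ℝ≥0∞} (hG : Measurable G)
    (hGinv : ∀ γ : ratH L e dV hdV dW hdW, ∀ y, G (((γ : HA L e dV hdV dW hdW)) * y) = G y)
    {β : HA L e dV hdV dW hdW → ℝ≥0∞} (hβ : IsCoveringWeight (ratH L e dV hdV dW hdW) β)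
    {S : Set (HA L e dV hdV dW hdW)} (hS : MeasurableSet S) {m : ℕ}
    (hfin : ∀ y : HA L e dV hdV dW hdW, (((ratH L e dV hdV dW hdW) : Set (HA L e dV hdV dW hdW)) ∩ y • S⁻¹).Finite)
    (hm : ∀ y : HA L e dV hdV dW hdW, (((ratH L e dV hdV dW hdW) : Set (HA L e dV hdV dW hdW)) ∩ y • S⁻¹).ncard ≤ m) :
    ∫⁻ y, S.indicator (fun _ => (1 : ℝ≥0∞)) y * G y ∂μ ≤ m * ∫⁻ y, G y * β y ∂μ := by
  classical
  haveI : Countable (ratH L e dV hdV dW hdW) := countable_ratH L e dV hdV dW hdW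
  have hβm : Measurable β := hβ.1
  have hGinv' : ∀ γ : ratH L e dV hdV dW hdW, ∀ y, G (((γ : HA L e dV hdV dW hdW))⁻¹ * y) = G y := fun γ y => by
    have h := hGinv γ (((γ : HA L e dV hdV dW hdW))⁻¹ * y)
    rw [mul_inv_cancel_left] at h
    exact h.symm
  -- insert the covering sum
  have hcov : ∀ y, (∑' γ : ratH L e dV hdV dW hdW, β (((γ : HA L e dV hdV dW hdW)) * y)) = 1 := fun y => by
    have h := hβ.2 y
    rw [coveringSum_apply] at h
    exact h
  have h1 : ∫⁻ y, S.indicator (fun _ => (1 : ℝ≥0∞)) y * G y ∂μ =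
      ∫⁻ y, ∑' γ : ratH L e dV hdV dW hdW, S.indicator (fun _ => (1 : ℝ≥0∞)) y * G y * β (((γ : HA L e dV hdV dW hdW)) * y) ∂μ := by
    refine lintegral_congr fun y => ?_
    rw [ENNReal.tsum_mul_left, hcov y, mul_one]
  have hmeas : ∀ γ : ratH L e dV hdV dW hdW, Measurable fun y =>
      S.indicator (fun _ => (1 : ℝ≥0∞)) y * G y * β (((γ : HA L e dV hdV dW hdW)) * y) := fun γ =>
    ((measurable_const.indicator hS).mul hG).mul (hβm.comp (measurable_const_mul _))
  rw [h1, lintegral_tsum fun γ => (hmeas γ).aemeasurable]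
  -- substitute `y ↦ γ⁻¹ y` in the `γ`-th term
  have h2 : ∀ γ : ratH L e dV hdV dW hdW,
      ∫⁻ y, S.indicator (fun _ => (1 : ℝ≥0∞)) y * G y * β (((γ : HA L e dV hdV dW hdW)) * y) ∂μ =
        ∫⁻ y, S.indicator (fun _ => (1 : ℝ≥0∞)) ((((γ : HA L e dV hdV dW hdW)))⁻¹ * y) * G y * β y ∂μ := fun γ => by
    rw [← lintegral_mul_left_eq_self (μ := μ) _ ((((γ : HA L e dV hdV dW hdW)))⁻¹)]
    refine lintegral_congr fun y => ?_
    rw [hGinv' γ y, mul_inv_cancel_left]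
  simp_rw [h2]
  have hmeas' : ∀ γ : ratH L e dV hdV dW hdW, Measurable fun y =>
      S.indicator (fun _ => (1 : ℝ≥0∞)) ((((γ : HA L e dV hdV dW hdW)))⁻¹ * y) * G y * β y := fun γ =>
    (((measurable_const.indicator hS).comp (measurable_const_mul _)).mul hG).mul hβm
  rw [← lintegral_tsum fun γ => (hmeas' γ).aemeasurable]
  -- pointwise bound by the multiplicity
  calc ∫⁻ y, ∑' γ : ratH L e dV hdV dW hdW, S.indicator (fun _ => (1 : ℝ≥0∞)) ((((γ : HA L e dV hdV dW hdW)))⁻¹ * y) * G y * β y ∂μ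
      = ∫⁻ y, (∑' γ : ratH L e dV hdV dW hdW, S.indicator (fun _ => (1 : ℝ≥0∞)) ((((γ : HA L e dV hdV dW hdW)))⁻¹ * y)) * (G y * β y) ∂μ := by
        refine lintegral_congr fun y => ?_
        rw [← ENNReal.tsum_mul_right]
        refine tsum_congr fun γ => ?_
        rw [mul_assoc]
    _ ≤ ∫⁻ y, (m : ℝ≥0∞) * (G y * β y) ∂μ :=
        lintegral_mono fun y => mul_le_mul' (tsum_indicator_inv_smul_le L e dV hdV dW hdW y (hfin y) (hm y)) le_rfl
    _ = m * ∫⁻ y, G y * β y ∂μ := by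
        rw [lintegral_const_mul' _ _ (ENNReal.natCast_ne_top m)]

/-! ## §3 The reduction of Godement's count to the Siegel-domain integral -/

omit [MeasurableSpace (HA L e dV hdV dW hdW)] [BorelSpace (HA L e dV hdV dW hdW)] in
/-- **Transfer between comparable heights.**  Two heights `Φ, Φ₀ > 0` of type `(P_Δ, modDelta)`, bounded above and below by positive
constants on the Iwasawa compact `K₀` (`H(𝔸) = P_Δ(𝔸)·K₀`), have bounded ratio on ALL of `H(𝔸)`; hence `Σ_γ Φ₀(γ h)^τ < ∞ ⟹ Σ_γ Φ(γ h)^τ < ∞`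
(`τ ≥ 0`).  So Godement's count for ONE such height (e.g. a measurable one) gives it for all. [cite: Garrett2018, §3.10] -/
theorem summable_rpow_of_comparable {K₀ : Set (HA L e dV hdV dW hdW)}
    (hPK : ∀ x : HA L e dV hdV dW hdW, ∃ p k : HA L e dV hdV dW hdW, IsSiegelDelta L e dV hdV dW hdW p ∧ k ∈ K₀ ∧ x = p * k)
    {Φ Φ₀ : HA L e dV hdV dW hdW → ℝ} (hΦpos : ∀ x, 0 < Φ x) (hΦ₀pos : ∀ x, 0 < Φ₀ x)
    (hΦ : ∀ p x : HA L e dV hdV dW hdW, IsSiegelDelta L e dV hdV dW hdW p → Φ (p * x) = modDelta L e dV hdV dW hdW p * Φ x)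
    (hΦ₀ : ∀ p x : HA L e dV hdV dW hdW, IsSiegelDelta L e dV hdV dW hdW p → Φ₀ (p * x) = modDelta L e dV hdV dW hdW p * Φ₀ x)
    {C c₀ : ℝ} (hc₀ : 0 < c₀) (hup : ∀ k ∈ K₀, Φ k ≤ C) (hlow : ∀ k ∈ K₀, c₀ ≤ Φ₀ k)
    {τ : ℝ} (hτ : 0 ≤ τ) {ι : Type*} {y : ι → HA L e dV hdV dW hdW} (hsum : Summable fun i => Φ₀ (y i) ^ τ) :
    Summable fun i => Φ (y i) ^ τ := by
  have hC : 0 ≤ C := by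
    obtain ⟨p, k, -, hk, -⟩ := hPK 1
    exact (hΦpos k).le.trans (hup k hk)
  -- `Φ(x) ≤ (C/c₀) Φ₀(x)` everywhere
  have hcmp : ∀ x, Φ x ≤ C / c₀ * Φ₀ x := fun x => by
    obtain ⟨p, k, hp, hk, rfl⟩ := hPK x
    have hmod : 0 < modDelta L e dV hdV dW hdW p := modDelta_pos L e dV hdV dW hdW p
    rw [hΦ p k hp, hΦ₀ p k hp, ← mul_assoc, mul_comm (C / c₀), mul_assoc]
    refine mul_le_mul_of_nonneg_left ?_ hmod.le
    rw [div_mul_eq_mul_div, le_div_iff₀ hc₀]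
    exact (mul_le_mul (hup k hk) (hlow k hk) hc₀.le hC)
  refine Summable.of_nonneg_of_le (fun i => Real.rpow_nonneg (hΦpos _).le τ)
    (fun i => ?_) (hsum.mul_left ((C / c₀) ^ τ))
  rw [← Real.mul_rpow (div_nonneg hC hc₀.le) (hΦ₀pos _).le]
  exact Real.rpow_le_rpow (hΦpos _).le (hcmp _) hτ

/-- **THE REDUCTION OF GODEMENT'S COUNT TO THE SIEGEL-DOMAIN INTEGRAL.**  Let `μ` be a left-invariant measure on `H(𝔸)`, finite on
compacta and positive on opens; `H(𝔸) = P_Δ(𝔸)·K₀` with `K₀` compact (★ (I)); `Φ > 0` a MEASURABLE height of type `(P_Δ, modDelta)`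
bounded below on compacta with Godement's floor (★ `exists_siegelHeight` gives (1)–(4); measurability is the extra analytic input, cf.
`summable_rpow_of_comparable`); `τ ≥ 0`; `β'` a `P_Δ(L⁺)`-covering weight (★ `exists_isCoveringWeight_siegelDeltaRat`).  IF the Siegel-domain
integrals `∫⁻ 1_{Φ ≤ C₀} Φ^τ β' dμ` are finite for every `C₀`, THEN `Σ_{γ ∈ P_Δ(L⁺)\H(L⁺)} Φ(γ h)^τ < ∞` for every `h ∈ H(𝔸)` — smear ★,
count ≤ integral ★, floor ★(4), E3a, unfold ★. [cite: Garrett2018, §3.10 (proof of Cor. 3.10.2)] [cite: MoeglinWaldspurger1995, II.1.5]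
[cite: Liu2021, Lem. B.10 (2) p. 102] -/
theorem summable_height_rpow_of_lintegral_ne_top (μ : Measure (HA L e dV hdV dW hdW)) [μ.IsMulLeftInvariant]
    [IsFiniteMeasureOnCompacts μ] [μ.IsOpenPosMeasure]
    {K₀ : Set (HA L e dV hdV dW hdW)} (hK₀ : IsCompact K₀)
    (hPK : ∀ x : HA L e dV hdV dW hdW, ∃ p k : HA L e dV hdV dW hdW, IsSiegelDelta L e dV hdV dW hdW p ∧ k ∈ K₀ ∧ x = p * k)
    {Φ : HA L e dV hdV dW hdW → ℝ} (hΦm : Measurable Φ) (hΦpos : ∀ x, 0 < Φ x)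
    (hΦ : ∀ p x : HA L e dV hdV dW hdW, IsSiegelDelta L e dV hdV dW hdW p → Φ (p * x) = modDelta L e dV hdV dW hdW p * Φ x)
    (hΦK : ∀ K : Set (HA L e dV hdV dW hdW), IsCompact K → ∃ c : ℝ, 0 < c ∧ ∀ k ∈ K, c ≤ Φ k)
    (hΦfloor : ∀ K : Set (HA L e dV hdV dW hdW), IsCompact K → ∃ C : ℝ, ∀ k ∈ K, ∀ γ : ratH L e dV hdV dW hdW,
      Φ ((γ : HA L e dV hdV dW hdW) * k) ≤ C)
    {τ : ℝ} (hτ : 0 ≤ τ)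
    {β' : HA L e dV hdV dW hdW → ℝ≥0∞} (hβ' : IsCoveringWeight (↥(siegelDelta L e dV hdV dW hdW ⊓ ratH L e dV hdV dW hdW)) β')
    (hE5 : ∀ C₀ : ℝ, ∫⁻ x, {x | Φ x ≤ C₀}.indicator (fun x => ENNReal.ofReal (Φ x ^ τ)) x * β' x ∂μ ≠ ∞)
    (h : HA L e dV hdV dW hdW) :
    Summable (fun q : SiegelDeltaQuot L e dV hdV dW hdW =>
      Φ (((Quotient.out q : ratH L e dV hdV dW hdW) : HA L e dV hdV dW hdW) * h) ^ τ) := by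
  classical
  haveI : Countable (ratH L e dV hdV dW hdW) := countable_ratH L e dV hdV dW hdW
  haveI : Countable (SiegelDeltaQuot L e dV hdV dW hdW) := by unfold SiegelDeltaQuot; exact inferInstance
  -- a compact neighbourhood `C` of `1`, of positive finite measure
  obtain ⟨C, hCc, hC1⟩ := exists_compact_mem_nhds (1 : HA L e dV hdV dW hdW)
  have hCmeas : MeasurableSet C := hCc.measurableSet
  have hC0 : μ C ≠ 0 := by
    obtain ⟨U, hUC, hUo, h1U⟩ := mem_nhds_iff.1 hC1
    exact (lt_of_lt_of_le (hUo.measure_pos μ ⟨1, h1U⟩) (measure_mono hUC)).ne'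
  have hCtop : μ C ≠ ∞ := hCc.measure_lt_top.ne
  -- (a) smear
  obtain ⟨B, hB1, hB⟩ := exists_smear_const_rpow L e dV hdV dW hdW hK₀ hPK hΦpos hΦ hΦK
    (upper_bound_of_floor L e dV hdV dW hdW hΦfloor) hCc hτ
  -- E2: it suffices that `Σ_q ∫⁻_{γ_q h C} Φ^τ < ∞`
  refine summable_of_tsum_setLIntegral_ne_top L e dV hdV dW hdW μ hCmeas hC0 hCtop (ψ := fun x => Φ x ^ τ)
    (fun x => Real.rpow_nonneg (hΦpos x).le τ) (le_trans zero_le_one hB1) (fun x c hc => (hB x c hc).1)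
    (fun q : SiegelDeltaQuot L e dV hdV dW hdW => ((Quotient.out q : ratH L e dV hdV dW hdW) : HA L e dV hdV dW hdW) * h) ?_
  -- the floor on `h • C`
  obtain ⟨C₀, hC₀⟩ := hΦfloor (h • C) (hCc.smul h)
  set F : HA L e dV hdV dW hdW → ℝ≥0∞ := fun x => {x | Φ x ≤ C₀}.indicator (fun x => ENNReal.ofReal (Φ x ^ τ)) x with hFdef
  have hFm : Measurable F := (hΦm.pow_const τ).ennreal_ofReal.indicator (measurableSet_le hΦm measurable_const)
  have hFinv : ∀ p ∈ siegelDelta L e dV hdV dW hdW ⊓ ratH L e dV hdV dW hdW, ∀ x : HA L e dV hdV dW hdW, F (p * x) = F x := by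
    intro p hp x
    have hΦpx : Φ (p * x) = Φ x := by
      rw [hΦ p x (Subgroup.mem_inf.1 hp).1, modDelta_eq_one_of_mem_ratH (Subgroup.mem_inf.1 hp).2, one_mul]
    simp only [hFdef, Set.indicator_apply, Set.mem_setOf_eq, hΦpx]
  -- the translate sum `G`
  set G : HA L e dV hdV dW hdW → ℝ≥0∞ := fun y => ∑' q : SiegelDeltaQuot L e dV hdV dW hdW,
    F ((((Quotient.out q : ratH L e dV hdV dW hdW) : HA L e dV hdV dW hdW)) * y) with hGdef
  have hGm : Measurable G := by
    show Measurable fun y => ∑' q : SiegelDeltaQuot L e dV hdV dW hdW,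
      F ((((Quotient.out q : ratH L e dV hdV dW hdW) : HA L e dV hdV dW hdW)) * y)
    simp_rw [ENNReal.tsum_eq_iSup_sum]
    exact Measurable.iSup fun s => Finset.measurable_sum s fun q _ => hFm.comp (measurable_const_mul _)
  have hGinv : ∀ γ : ratH L e dV hdV dW hdW, ∀ y, G (((γ : HA L e dV hdV dW hdW)) * y) = G y :=
    fun γ y => translateSum_ratH_mul L e dV hdV dW hdW hFinv γ y
  -- (4a)+(4b): `Σ_q ∫⁻_{γ_q h • C} ofReal(Φ^τ) = ∫⁻ 1_{h•C} G`
  have hS : MeasurableSet (h • C) := hCmeas.const_smul h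
  have hterm : ∀ q : SiegelDeltaQuot L e dV hdV dW hdW,
      ∫⁻ x in ((((Quotient.out q : ratH L e dV hdV dW hdW) : HA L e dV hdV dW hdW)) * h) • C, ENNReal.ofReal (Φ x ^ τ) ∂μ =
        ∫⁻ c in C, F ((((Quotient.out q : ratH L e dV hdV dW hdW) : HA L e dV hdV dW hdW)) * (h * c)) ∂μ := by
    intro q
    rw [setLIntegral_translate_eq L e dV hdV dW hdW μ hCmeas _ _]
    refine setLIntegral_congr_fun hCmeas fun c hc => ?_
    have hle : Φ ((((Quotient.out q : ratH L e dV hdV dW hdW) : HA L e dV hdV dW hdW)) * (h * c)) ≤ C₀ :=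
      hC₀ (h * c) (Set.smul_mem_smul_set hc) _
    show ENNReal.ofReal (Φ (_ * c) ^ τ) = F _
    rw [mul_assoc, hFdef]
    dsimp only
    rw [Set.indicator_of_mem (show _ ∈ {x | Φ x ≤ C₀} from hle)]
  have hsumint : (∑' q : SiegelDeltaQuot L e dV hdV dW hdW,
      ∫⁻ x in ((((Quotient.out q : ratH L e dV hdV dW hdW) : HA L e dV hdV dW hdW)) * h) • C, ENNReal.ofReal (Φ x ^ τ) ∂μ) =
        ∫⁻ y, (h • C).indicator (fun _ => (1 : ℝ≥0∞)) y * G y ∂μ := by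
    simp_rw [hterm]
    have hmeasq : ∀ q : SiegelDeltaQuot L e dV hdV dW hdW, Measurable fun c : HA L e dV hdV dW hdW =>
        F ((((Quotient.out q : ratH L e dV hdV dW hdW) : HA L e dV hdV dW hdW)) * (h * c)) := fun q =>
      hFm.comp ((measurable_const_mul _).comp (measurable_const_mul _))
    rw [← lintegral_tsum fun q => (hmeasq q).aemeasurable]
    -- `∫⁻_C G(h c) = ∫⁻_{h•C} G = ∫⁻ 1_{h•C} G`
    rw [← setLIntegral_translate_eq L e dV hdV dW hdW μ hCmeas G h, ← lintegral_indicator hS]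
    refine lintegral_congr fun y => ?_
    rw [← Set.indicator_mul_left _ (fun _ => (1 : ℝ≥0∞)) G]
    simp only [one_mul]
  rw [hsumint]
  -- E3a with the multiplicity of `h • C`
  obtain ⟨m, hm⟩ := exists_ncard_ratH_inter_mul_le L e dV hdV dW hdW (hCc.smul h).inv
  obtain ⟨β, hβ⟩ := exists_isCoveringWeight_ratH L e dV hdV dW hdW
  have hE3a := lintegral_indicator_mul_le_of_invariant L e dV hdV dW hdW μ hGm hGinv hβ hS
    (fun y => finite_ratH_inter_mul L e dV hdV dW hdW (hCc.smul h).inv y) hm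
  -- E3b unfold, then E5
  have hE3b := lintegral_tsum_translate_mul_weight_eq L e dV hdV dW hdW μ hFm hFinv hβ hβ'
  refine ne_top_of_le_ne_top (ENNReal.mul_ne_top (ENNReal.natCast_ne_top m) ?_) hE3a
  rw [show (fun y => G y * β y) = fun y => (∑' q : SiegelDeltaQuot L e dV hdV dW hdW,
      F ((((Quotient.out q : ratH L e dV hdV dW hdW) : HA L e dV hdV dW hdW)) * y)) * β y from rfl, hE3b]
  exact hE5 C₀

end Summit.HodgeConjecture.HodgeConjecture.Cruxes.HLiu418.K2LiuSiegelDoubledCountReduction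

end
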